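import Literature.Geometry.Symplectic.SteinHandleDomain
import HarnessLib

/-!
# Rescaling Eliashberg's handle profile

Topic `Literature/Geometry/Symplectic`; proofs file of the fact seat of
`Literature.Geometry.Symplectic.Gompf1998_thm13_twoHandles` (**E2**, `SteinTwoHandles.lean`).
Forstnerič–Kozak 2003, proof of Prop. 3.1: *"Without loss of generality we may take `a = 1` …
(the general case follows by rescaling)"*.  The inequalities (3.1),
`h (h'' + h'³/u) < 1` and `h h'/u < 1`, are invariant under the rescaling
`h ↦ h_s`, `h_s(u) = s·h(u/s)` (`s > 0`), and so is the whole package `HandleProfile`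
(`SteinHandleDomain.lean`): `HandleProfile h σ r₀ → HandleProfile h_s (sσ) (sr₀)`
(`HandleProfile.scale`).  The handlebody of `h_s` is the homothetic image `s·K` of that of `h`
(`thetaK_scale`: `θ_{K_s}(S) = s² θ_K(S/s²)`), with centre `D_{λ, s²} ∪ s·M`; this puts the
model Stein `2`-handle at any scale, e.g. inside the unit ball of `ℂ²`.

Everything is **proved**; no definition, no named fact.

## References

* F. Forstnerič, J. Kozak, *Strongly pseudoconvex handlebodies*, J. Korean Math. Soc. 40
  (2003), 727–745, proof of Prop. 3.1. [ForstnericKozak2003]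
-/

noncomputable section

open Set Filter
open scoped Topology ContDiff

namespace Literature.Geometry.Symplectic

namespace HandleProfile

variable {h : ℝ → ℝ} {σ r₀ s : ℝ}

/-- The first derivative of the rescaled profile: `(s·h(·/s))'(u) = h'(u/s)`. [folklore] -/
theorem hasDerivAt_scale (hd : ∀ r, HasDerivAt h (deriv h r) r) (hs : s ≠ 0) (u : ℝ) :
    HasDerivAt (fun u => s * h (u / s)) (deriv h (u / s)) u := by
  have h1 : HasDerivAt (fun u : ℝ => u / s) (1 / s) u := by
    simpa using (hasDerivAt_id u).div_const s
  have h2 := ((hd (u / s)).comp u h1).const_mul s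
  refine h2.congr_deriv ?_
  field_simp

/-- `deriv` form. [folklore] -/
theorem deriv_scale (hd : ∀ r, HasDerivAt h (deriv h r) r) (hs : s ≠ 0) :
    deriv (fun u => s * h (u / s)) = fun u => deriv h (u / s) :=
  funext fun u => (hasDerivAt_scale hd hs u).deriv

/-- The second derivative of the rescaled profile: `(s·h(·/s))''(u) = h''(u/s)/s`. [folklore] -/
theorem deriv_deriv_scale (hd : ∀ r, HasDerivAt h (deriv h r) r)
    (hdd : ∀ r, HasDerivAt (deriv h) (deriv (deriv h) r) r) (hs : s ≠ 0) (u : ℝ) :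
    deriv (deriv fun u => s * h (u / s)) u = deriv (deriv h) (u / s) / s := by
  rw [deriv_scale hd hs]
  have h1 : HasDerivAt (fun u : ℝ => u / s) (1 / s) u := by
    simpa using (hasDerivAt_id u).div_const s
  have h2 : HasDerivAt (fun u => deriv h (u / s)) (deriv (deriv h) (u / s) * (1 / s)) u := by
    have := (hdd (u / s)).comp u h1
    exact this
  rw [h2.deriv]
  field_simp

/-- **Rescaling a handle profile** (Forstnerič–Kozak: *"the general case follows by
rescaling"*): if `h` is a handle profile with tube radius `σ` and flat range `r₀`, then so is
`h_s(u) = s·h(u/s)` with `sσ`, `sr₀`, for every `s > 0`. [cite: ForstnericKozak2003, Prop. 3.1] -/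
theorem scale (H : HandleProfile h σ r₀) (hs : 0 < s) :
    HandleProfile (fun u => s * h (u / s)) (s * σ) (s * r₀) := by
  have hd : ∀ r, HasDerivAt h (deriv h r) r := fun r =>
    (H.smooth.differentiable (by simp)).differentiableAt.hasDerivAt
  have hdd : ∀ r, HasDerivAt (deriv h) (deriv (deriv h) r) r := fun r => by
    have : ContDiff ℝ ∞ (deriv h) := H.smooth.iterate_deriv 1
    exact (this.differentiable (by simp)).differentiableAt.hasDerivAt
  refine
    { smooth := contDiff_const.mul (H.smooth.comp (contDiff_id.div_const s))
      σ_pos := mul_pos hs H.σ_pos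
      r₀_pos := mul_pos hs H.r₀_pos
      eq_σ := fun u hu => ?_
      σ_le := fun u => ?_
      shape := fun u hu => ?_ }
  · show s * h (u / s) = s * σ
    rw [H.eq_σ (u / s) (by rw [div_le_iff₀ hs]; linarith)]
  · show s * σ ≤ s * h (u / s)
    exact mul_le_mul_of_nonneg_left (H.σ_le _) hs.le
  · -- the inequalities (3.1) are scale invariant
    have hus : 0 < u / s := div_pos hu hs
    obtain ⟨h1, h2⟩ := H.shape (u / s) hus
    rw [deriv_deriv_scale hd hdd hs.ne', deriv_scale hd hs.ne']
    have hpos := H.pos (u / s)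
    constructor
    · have : s * h (u / s) * (deriv (deriv h) (u / s) / s + deriv h (u / s) ^ 3 / u) =
          h (u / s) * (deriv (deriv h) (u / s) + deriv h (u / s) ^ 3 / (u / s)) := by
        field_simp
      rw [this]; exact h1
    · have : s * h (u / s) * deriv h (u / s) / u = h (u / s) * deriv h (u / s) / (u / s) := by
        field_simp
      rw [this]; exact h2

/-- **The handlebody of the rescaled profile is the homothetic image**:
`θ_{K_s}(S) = h_s(√S)² = s²·h(√S/s)² = s²·θ_K(S/s²)` for `S ≥ 0`. [folklore] -/
theorem thetaK_scale (hs : 0 < s) {S : ℝ} (hS : 0 ≤ S) :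
    thetaK (fun u => s * h (u / s)) S = s ^ 2 * thetaK h (S / s ^ 2) := by
  rw [thetaK_apply, thetaK_apply]
  have : Real.sqrt (S / s ^ 2) = Real.sqrt S / s := by
    rw [Real.sqrt_div hS, Real.sqrt_sq hs.le]
  rw [this]; ring

/-- Membership in the rescaled handlebody: `ρ_{K_s}(w) ≤ 0 ↔ ρ_K(w/s) ≤ 0`. [folklore] -/
theorem spherical_thetaK_scale (hs : 0 < s) (w : EuclideanSpace ℝ (Fin 4)) :
    spherical (thetaK fun u => s * h (u / s)) w = s ^ 2 * spherical (thetaK h) (s⁻¹ • w) := by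
  rw [spherical_apply, spherical_apply, thetaK_scale hs (by positivity)]
  simp only [PiLp.smul_apply, smul_eq_mul]
  have hs0 : s ≠ 0 := hs.ne'
  field_simp

end HandleProfile

end Literature.Geometry.Symplectic

end
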